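import Literature.Topology.FourManifolds.TangentFrameAlongMap
import Literature.Topology.FourManifolds.TransversalFieldAlongArc
import Literature.Topology.FourManifolds.StraightLineIsotopyExtension
import Literature.Topology.FourManifolds.BandFrames
import HarnessLib

/-!
# The collar of the Whitney disc in the manifold (Milnor 1965, proof of Lemma 6.7, PDF pp. 41–43):
# geometry along the two arcs

Topic `Literature/Topology/FourManifolds`; input of the construction of the Whitney disc in
Milnor, *Lectures on the h-cobordism theorem* (1965), proof of Lemma 6.7 (the tree's leaf
`Literature.Topology.FourManifolds.Milnor1965_whitney_isotopy`, reduced in the tree to Lemma 6.7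
in sheet form, `WhitneyModelSheets.lean`).  The tree formalises Milnor's Riemannian constructions
metric-free, through a Whitney embedding `ι : V → ℝᴺ` and the normal retraction `r` of a tube
about `ι(V)` (`NormalRetraction.lean`): a map into `V` is written `r ∘ g` with `g` valued in the
ambient space, and its differential is controlled by the part of `dg` off the normal space.  This
file provides that calculus and the **forbidden frames** along an arc `C = m(·, 0) ⊂ M ⊂ V`
(frames of `T_C ιM ⊕ N_C ιV`, smooth in the parameter), which are the data fed to the plane-model
collar formula (`WhitneyDiscCollarFormula.lean`) and to the transversal fields along the arcs
(`TransversalFieldAlongArc.lean`; Milnor, PDF p. 41: *"extend this to a field of 2-planes along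
`C ∪ C'`"*, p. 42: the normal fields along `C`, `C'`).

* `Literature.Topology.FourManifolds.mfderiv_retraction_comp_mfderiv'` — `dr ∘ dι = id`;
* `Literature.Topology.FourManifolds.injective_mfderiv_retraction_comp` — `d(r ∘ g)` is
  injective as soon as `dg` is injective with range meeting the normal space trivially;
* `Literature.Topology.FourManifolds.range_fderiv_comp_le_tangentPlane` — `d(ι ∘ m) ⊆ T ιV`;
* `Literature.Topology.FourManifolds.exists_forbiddenFrame` — along `x ↦ m(x, 0)`, a smooth
  family of injective linear maps `A(x)` with `range A(x) = d(ι ∘ m)(x, 0)(ℝ × F) ⊕ N_{m(x,0)}`.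

Everything is proved; no definitions, no named facts.

## References

* J. Milnor, *Lectures on the h-cobordism theorem*, notes by L. Siebenmann and J. Sondow,
  Princeton Mathematical Notes (1965), proof of Lemma 6.7, PDF pp. 41–43.  Held:
  `lit read book:milnornd-lectures-h-cobordism-theorem --pages 41-45`. [MilnorHCobordism1965]
* M. W. Hirsch, *Differential Topology*, GTM 33 (1976), Ch. 4 §5 (tubular neighbourhoods).
  [HirschDT1976]
-/

open Set Function Filter Module Metric
open scoped Manifold ContDiff Topology RealInnerProductSpace

noncomputable section

namespace Literature.Topology.FourManifolds

variable {n N : ℕ} {V : Type*} [TopologicalSpace V] [ChartedSpace (EuclideanSpace ℝ (Fin n)) V]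
  [IsManifold (𝓡 n) ∞ V]

/-! ### Calculus of the retraction -/

omit [IsManifold (𝓡 n) ∞ V] in
/-- **`dr ∘ dι = id`** for a retraction `r` of a neighbourhood `T` of `ι(V)` onto `V`
(`r ∘ ι = id`), by the chain rule. [folklore] -/
theorem mfderiv_retraction_comp_mfderiv' {ι : V → EuclideanSpace ℝ (Fin N)}
    {T : Set (EuclideanSpace ℝ (Fin N))} {rV : EuclideanSpace ℝ (Fin N) → V}
    (hι : ContMDiff (𝓡 n) 𝓘(ℝ, EuclideanSpace ℝ (Fin N)) ∞ ι) (hT : IsOpen T)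
    (hr : ContMDiffOn 𝓘(ℝ, EuclideanSpace ℝ (Fin N)) (𝓡 n) ∞ rV T) (hιT : ∀ v, ι v ∈ T)
    (hrι : ∀ v, rV (ι v) = v) (v : V) :
    (mfderiv 𝓘(ℝ, EuclideanSpace ℝ (Fin N)) (𝓡 n) rV (ι v)).comp
        (mfderiv (𝓡 n) 𝓘(ℝ, EuclideanSpace ℝ (Fin N)) ι v) =
      ContinuousLinearMap.id ℝ (TangentSpace (𝓡 n) v) := by
  have hrd : MDifferentiableAt 𝓘(ℝ, EuclideanSpace ℝ (Fin N)) (𝓡 n) rV (ι v) :=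
    (hr.contMDiffAt (hT.mem_nhds (hιT v))).mdifferentiableAt (by simp)
  have hιd : MDifferentiableAt (𝓡 n) 𝓘(ℝ, EuclideanSpace ℝ (Fin N)) ι v :=
    (hι v).mdifferentiableAt (by simp)
  have hcomp : rV ∘ ι = id := funext hrι
  rw [← mfderiv_comp v hrd hιd, hcomp, mfderiv_id]

omit [IsManifold (𝓡 n) ∞ V] in
/-- **The differential of `r ∘ g` is injective when `dg` is injective off the normal space.**
Let `r : T → V` be a smooth retraction of an open neighbourhood of `ι(V)` (`r ∘ ι = id`) whose
differential at the points of `ι(V)` kills the normal space `N_v = (T_v ιV)ᗮ`, and let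
`g : X → ℝᴺ` be differentiable at `u` with `g u = ι v` and `dg_u w ∈ N_v ⇒ w = 0`.  Then
`d(r ∘ g)_u` is injective (`dr = dι⁻¹ ∘ P_T` on `T ⊕ N`). [folklore] -/
theorem injective_mfderiv_retraction_comp {ι : V → EuclideanSpace ℝ (Fin N)}
    {T : Set (EuclideanSpace ℝ (Fin N))} {rV : EuclideanSpace ℝ (Fin N) → V}
    (hι : ContMDiff (𝓡 n) 𝓘(ℝ, EuclideanSpace ℝ (Fin N)) ∞ ι) (hT : IsOpen T)
    (hr : ContMDiffOn 𝓘(ℝ, EuclideanSpace ℝ (Fin N)) (𝓡 n) ∞ rV T) (hιT : ∀ v, ι v ∈ T)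
    (hrι : ∀ v, rV (ι v) = v)
    (hrN : ∀ v, ∀ w ∈ (tangentPlane (𝓡 n) ι v)ᗮ,
      mfderiv 𝓘(ℝ, EuclideanSpace ℝ (Fin N)) (𝓡 n) rV (ι v) w = 0)
    {X : Type*} [NormedAddCommGroup X] [NormedSpace ℝ X] {g : X → EuclideanSpace ℝ (Fin N)}
    {u : X} {v : V} (hg : DifferentiableAt ℝ g u) (hgu : g u = ι v)
    (hB : ∀ w, fderiv ℝ g u w ∈ (tangentPlane (𝓡 n) ι v)ᗮ → w = 0) :
    Injective (mfderiv 𝓘(ℝ, X) (𝓡 n) (rV ∘ g) u) := by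
  -- plain-typed differentials
  set L : EuclideanSpace ℝ (Fin N) →L[ℝ] EuclideanSpace ℝ (Fin n) :=
    mfderiv 𝓘(ℝ, EuclideanSpace ℝ (Fin N)) (𝓡 n) rV (ι v) with hL
  set Dι : EuclideanSpace ℝ (Fin n) →L[ℝ] EuclideanSpace ℝ (Fin N) :=
    mfderiv (𝓡 n) 𝓘(ℝ, EuclideanSpace ℝ (Fin N)) ι v with hDι
  have hrd : MDifferentiableAt 𝓘(ℝ, EuclideanSpace ℝ (Fin N)) (𝓡 n) rV (ι v) :=
    (hr.contMDiffAt (hT.mem_nhds (hιT v))).mdifferentiableAt (by simp)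
  have hr' : HasMFDerivAt 𝓘(ℝ, EuclideanSpace ℝ (Fin N)) (𝓡 n) rV (g u) L := by
    rw [hgu]; exact hrd.hasMFDerivAt
  have hg' : HasMFDerivAt 𝓘(ℝ, X) 𝓘(ℝ, EuclideanSpace ℝ (Fin N)) g u (fderiv ℝ g u) :=
    hg.hasFDerivAt.hasMFDerivAt
  have hchain : mfderiv 𝓘(ℝ, X) (𝓡 n) (rV ∘ g) u = L.comp (fderiv ℝ g u) :=
    (hr'.comp u hg').mfderiv
  have hLι : ∀ a, L (Dι a) = a := fun a => by
    have := ContinuousLinearMap.ext_iff.1 (mfderiv_retraction_comp_mfderiv' hι hT hr hιT hrι v) a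
    exact this
  have hLN : ∀ w ∈ (tangentPlane (𝓡 n) ι v)ᗮ, L w = 0 := fun w hw => hrN v w hw
  rw [hchain]
  refine (injective_iff_map_eq_zero _).2 fun w hw => ?_
  have hy : L (fderiv ℝ g u w) = 0 := hw
  set y : EuclideanSpace ℝ (Fin N) := fderiv ℝ g u w with hy_def
  obtain ⟨a, ha'⟩ : ∃ a : EuclideanSpace ℝ (Fin n), Dι a = tangentProj (𝓡 n) ι v y :=
    tangentProj_apply_mem ι v y
  have ha0 : a = 0 := by
    have h1 : L y = L (tangentProj (𝓡 n) ι v y) + L (y - tangentProj (𝓡 n) ι v y) := by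
      rw [← map_add, add_sub_cancel]
    rw [hy, hLN _ (sub_tangentProj_apply_mem_orthogonal ι v y), add_zero, ← ha', hLι] at h1
    exact h1.symm
  have hPy : tangentProj (𝓡 n) ι v y = 0 := by rw [← ha', ha0, map_zero]
  have hyN : y ∈ (tangentPlane (𝓡 n) ι v)ᗮ := by
    have := sub_tangentProj_apply_mem_orthogonal (I := 𝓡 n) ι v y
    rwa [hPy, sub_zero] at this
  exact hB w hyN

omit [IsManifold (𝓡 n) ∞ V] in
/-- The differential of `ι ∘ m` at a point, for `m` a smooth map from a vector space into `V`,
takes values in the tangent plane `T_{m z} ιV`. [folklore] -/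
theorem range_fderiv_comp_le_tangentPlane {ι : V → EuclideanSpace ℝ (Fin N)}
    (hι : ContMDiff (𝓡 n) 𝓘(ℝ, EuclideanSpace ℝ (Fin N)) ∞ ι)
    {X : Type*} [NormedAddCommGroup X] [NormedSpace ℝ X] {m : X → V}
    (hm : ContMDiff 𝓘(ℝ, X) (𝓡 n) ∞ m) (z : X) :
    LinearMap.range (fderiv ℝ (ι ∘ m) z : X →ₗ[ℝ] EuclideanSpace ℝ (Fin N)) ≤
      tangentPlane (𝓡 n) ι (m z) := by
  have hchain : fderiv ℝ (ι ∘ m) z =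
      (mfderiv (𝓡 n) 𝓘(ℝ, EuclideanSpace ℝ (Fin N)) ι (m z)).comp (mfderiv 𝓘(ℝ, X) (𝓡 n) m z) := by
    rw [← mfderiv_eq_fderiv, mfderiv_comp z ((hι (m z)).mdifferentiableAt (by simp))
      ((hm z).mdifferentiableAt (by simp))]
  rintro _ ⟨w, rfl⟩
  rw [ContinuousLinearMap.coe_coe, hchain]
  exact ⟨_, rfl⟩

omit [IsManifold (𝓡 n) ∞ V] in
/-- The differential of `ι ∘ m` is injective when `ι` and `m` are immersions. [folklore] -/
theorem injective_fderiv_comp_of_immersions {ι : V → EuclideanSpace ℝ (Fin N)}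
    (hι : ContMDiff (𝓡 n) 𝓘(ℝ, EuclideanSpace ℝ (Fin N)) ∞ ι)
    (hιimm : ∀ v, Injective (mfderiv (𝓡 n) 𝓘(ℝ, EuclideanSpace ℝ (Fin N)) ι v))
    {X : Type*} [NormedAddCommGroup X] [NormedSpace ℝ X] {m : X → V}
    (hm : ContMDiff 𝓘(ℝ, X) (𝓡 n) ∞ m) {z : X}
    (himm : Injective (mfderiv 𝓘(ℝ, X) (𝓡 n) m z)) : Injective (fderiv ℝ (ι ∘ m) z) := by
  have hchain : fderiv ℝ (ι ∘ m) z =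
      (mfderiv (𝓡 n) 𝓘(ℝ, EuclideanSpace ℝ (Fin N)) ι (m z)).comp (mfderiv 𝓘(ℝ, X) (𝓡 n) m z) := by
    rw [← mfderiv_eq_fderiv, mfderiv_comp z ((hι (m z)).mdifferentiableAt (by simp))
      ((hm z).mdifferentiableAt (by simp))]
  rw [hchain]
  exact (hιimm (m z)).comp himm

/-! ### Forbidden frames along an arc -/

/-- **Forbidden frames along an arc** (Milnor 1965, PDF pp. 41–42: the tangent planes of `M` and
the normal directions of `V` along `C`, as the directions the disc must avoid when leaving `C`).
Let `ι : V → ℝᴺ` be a smooth immersion of the `n`-manifold `V` and `m : ℝ × F → V` a smooth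
immersion (a product neighbourhood of the arc `x ↦ m(x, 0)` in a submanifold `M`).  Then on an
open `O ⊇ [-1, 1]` there is a smooth family of injective linear maps
`A(x) : ℝᵏ → ℝᴺ`, `k = dim(ℝ × F) + (N - n)`, with
`range A(x) = d(ι ∘ m)(x, 0)(ℝ × F) ⊕ (T_{m(x,0)} ιV)ᗮ` (tangent frame of `V` along the arc,
`TangentFrameAlongMap.lean`; its orthogonal complement frame, `ComplementaryFrameTransport.lean`).
[cite: MilnorHCobordism1965, proof of Lemma 6.7 (PDF pp. 41–42)] -/
theorem exists_forbiddenFrame {F : Type*} [NormedAddCommGroup F] [NormedSpace ℝ F]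
    [FiniteDimensional ℝ F] {ι : V → EuclideanSpace ℝ (Fin N)}
    (hι : ContMDiff (𝓡 n) 𝓘(ℝ, EuclideanSpace ℝ (Fin N)) ∞ ι)
    (hιimm : ∀ v, Injective (mfderiv (𝓡 n) 𝓘(ℝ, EuclideanSpace ℝ (Fin N)) ι v))
    {m : ℝ × F → V} (hm : ContMDiff 𝓘(ℝ, ℝ × F) (𝓡 n) ∞ m)
    (himm : ∀ z, Injective (mfderiv 𝓘(ℝ, ℝ × F) (𝓡 n) m z))
    {k : ℕ} (hk : k = finrank ℝ (ℝ × F) + (N - n)) (hnN : n ≤ N) :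
    ∃ (O : Set ℝ) (A : ℝ → (EuclideanSpace ℝ (Fin k) →L[ℝ] EuclideanSpace ℝ (Fin N))),
      IsOpen O ∧ Icc (-1 : ℝ) 1 ⊆ O ∧ ContDiffOn ℝ ∞ A O ∧
      ∀ x ∈ O, Injective (A x) ∧
        LinearMap.range (A x : EuclideanSpace ℝ (Fin k) →ₗ[ℝ] EuclideanSpace ℝ (Fin N)) =
          LinearMap.range (fderiv ℝ (ι ∘ m) (x, 0) : ℝ × F →ₗ[ℝ] EuclideanSpace ℝ (Fin N)) ⊔
            (tangentPlane (𝓡 n) ι (m (x, 0)))ᗮ := by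
  -- the arc and the tangent frame of `V` along it
  set c : ℝ → V := fun x => m (x, 0) with hc
  have h0 : ContMDiff 𝓘(ℝ, ℝ) 𝓘(ℝ, ℝ × F) ∞ (fun x : ℝ => ((x, 0) : ℝ × F)) :=
    (contDiff_id.prodMk contDiff_const).contMDiff
  have hcd : ContMDiffOn 𝓘(ℝ, ℝ) (𝓡 n) ∞ c univ := (hm.comp h0).contMDiffOn
  obtain ⟨W₁, Fr, hW₁o, hW₁c, hIW₁, -, hFrd, hFr⟩ :=
    exists_contDiffOn_tangentFrame (I := 𝓡 n) hι hιimm isCompact_Icc (convex_Icc (-1 : ℝ) 1)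
      ⟨0, by norm_num, by norm_num⟩ isOpen_univ (subset_univ _) hcd
  -- the normal frame
  have hdimN : n + finrank ℝ (EuclideanSpace ℝ (Fin (N - n))) =
      finrank ℝ (EuclideanSpace ℝ (Fin N)) := by
    simp only [finrank_euclideanSpace_fin]; omega
  obtain ⟨O, Nf, hOo, -, hIO, hOW₁, hNfd, hNf⟩ :=
    exists_contDiffOn_complementaryFrame hdimN isCompact_Icc (convex_Icc (-1 : ℝ) 1)
      ⟨0, by norm_num, by norm_num⟩ hW₁o hIW₁ hFrd (fun x hx => (hFr x (hIW₁ hx)).1)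
  -- the tangent part: `D x = d(ι ∘ m)(x, 0)`
  have hιm : ContDiff ℝ ∞ (ι ∘ m) := by
    rw [← contMDiff_iff_contDiff]; exact hι.comp hm
  set D : ℝ → (ℝ × F →L[ℝ] EuclideanSpace ℝ (Fin N)) := fun x => fderiv ℝ (ι ∘ m) (x, 0) with hD
  have hDd : ContDiff ℝ ∞ D :=
    (contDiff_infty_iff_fderiv.1 hιm).2.comp (contDiff_id.prodMk contDiff_const)
  -- the Euclidean reparametrisation of the source
  have hfin : finrank ℝ (EuclideanSpace ℝ (Fin k)) =
      finrank ℝ ((ℝ × F) × EuclideanSpace ℝ (Fin (N - n))) := by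
    rw [finrank_euclideanSpace_fin, finrank_prod, finrank_euclideanSpace_fin, hk]
  set iso : EuclideanSpace ℝ (Fin k) ≃L[ℝ] (ℝ × F) × EuclideanSpace ℝ (Fin (N - n)) :=
    ContinuousLinearEquiv.ofFinrankEq hfin with hiso
  set A : ℝ → (EuclideanSpace ℝ (Fin k) →L[ℝ] EuclideanSpace ℝ (Fin N)) := fun x =>
    ((D x).comp (ContinuousLinearMap.fst ℝ (ℝ × F) (EuclideanSpace ℝ (Fin (N - n)))) +
      (Nf x).comp (ContinuousLinearMap.snd ℝ (ℝ × F) (EuclideanSpace ℝ (Fin (N - n))))).comp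
      (iso : EuclideanSpace ℝ (Fin k) →L[ℝ] (ℝ × F) × EuclideanSpace ℝ (Fin (N - n))) with hA
  have hAd : ContDiffOn ℝ ∞ A O :=
    ((hDd.contDiffOn.clm_comp contDiffOn_const).add (hNfd.clm_comp contDiffOn_const)).clm_comp
      contDiffOn_const
  have hAapply : ∀ x w, A x w = D x (iso w).1 + Nf x (iso w).2 := fun x w => rfl
  -- the normal frame spans the normal space
  have hNfN : ∀ x ∈ O, ∀ b, Nf x b ∈ (tangentPlane (𝓡 n) ι (m (x, 0)))ᗮ := fun x hx b => by
    rw [Submodule.mem_orthogonal]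
    intro t ht
    rw [← (hFr x (hOW₁ hx)).2.2] at ht
    obtain ⟨a, rfl⟩ := ht
    exact (hNf x hx).2.2.2.1 a b
  have hTN : ∀ x, tangentPlane (𝓡 n) ι (m (x, 0)) ⊓ (tangentPlane (𝓡 n) ι (m (x, 0)))ᗮ = ⊥ :=
    fun x => Submodule.inf_orthogonal_eq_bot _
  have hrangeN : ∀ x ∈ O,
      LinearMap.range (Nf x : EuclideanSpace ℝ (Fin (N - n)) →ₗ[ℝ] EuclideanSpace ℝ (Fin N)) =
      (tangentPlane (𝓡 n) ι (m (x, 0)))ᗮ := fun x hx => by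
    apply Submodule.eq_of_le_of_finrank_eq
    · rintro _ ⟨b, rfl⟩; exact hNfN x hx b
    · have h1 : finrank ℝ (tangentPlane (𝓡 n) ι (m (x, 0))) = n := by
        have h := LinearMap.finrank_range_of_inj (hιimm (m (x, 0)))
        have h' : finrank ℝ (TangentSpace (𝓡 n) (m (x, 0))) = n := finrank_euclideanSpace_fin
        rw [h'] at h
        exact h
      have h2 := Submodule.finrank_add_finrank_orthogonal (tangentPlane (𝓡 n) ι (m (x, 0)))
      rw [h1, finrank_euclideanSpace_fin] at h2
      rw [LinearMap.finrank_range_of_inj (hNf x hx).2.1, finrank_euclideanSpace_fin]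
      omega
  refine ⟨O, A, hOo, hIO, hAd, fun x hx => ⟨?_, ?_⟩⟩
  · -- injectivity
    intro w₁ w₂ h
    have h0 : A x (w₁ - w₂) = 0 := by rw [map_sub, h, sub_self]
    rw [hAapply] at h0
    set a := (iso (w₁ - w₂)).1
    set b := (iso (w₁ - w₂)).2
    have hDa : D x a ∈ tangentPlane (𝓡 n) ι (m (x, 0)) :=
      range_fderiv_comp_le_tangentPlane hι hm (x, 0) ⟨a, rfl⟩
    have hNb : Nf x b ∈ (tangentPlane (𝓡 n) ι (m (x, 0)))ᗮ := hNfN x hx b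
    have hDa' : D x a ∈ (tangentPlane (𝓡 n) ι (m (x, 0)))ᗮ := by
      have : D x a = -Nf x b := eq_neg_of_add_eq_zero_left h0
      rw [this]; exact Submodule.neg_mem _ hNb
    have hDa0 : D x a = 0 := by
      have : D x a ∈ tangentPlane (𝓡 n) ι (m (x, 0)) ⊓ (tangentPlane (𝓡 n) ι (m (x, 0)))ᗮ :=
        ⟨hDa, hDa'⟩
      rw [hTN x] at this
      exact this
    have ha0 : a = 0 :=
      (injective_fderiv_comp_of_immersions hι hιimm hm (himm (x, 0))) (by
        rw [map_zero]; exact hDa0)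
    have hb0 : b = 0 := (hNf x hx).2.1 (by
      rw [map_zero]; rw [hDa0, zero_add] at h0; exact h0)
    have : iso (w₁ - w₂) = 0 := Prod.ext ha0 hb0
    exact sub_eq_zero.1 (iso.injective (this.trans (map_zero iso).symm))
  · -- the range
    apply le_antisymm
    · rintro _ ⟨w, rfl⟩
      rw [ContinuousLinearMap.coe_coe, hAapply]
      exact Submodule.add_mem_sup ⟨_, rfl⟩ (hNfN x hx _)
    · apply sup_le
      · rintro _ ⟨a, rfl⟩
        refine ⟨iso.symm (a, 0), ?_⟩
        rw [ContinuousLinearMap.coe_coe, hAapply, ContinuousLinearEquiv.apply_symm_apply]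
        simp [hD]
      · intro y hy
        rw [← hrangeN x hx] at hy
        obtain ⟨b, rfl⟩ := hy
        refine ⟨iso.symm (0, b), ?_⟩
        rw [ContinuousLinearMap.coe_coe, hAapply, ContinuousLinearEquiv.apply_symm_apply]
        simp

end Literature.Topology.FourManifolds
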